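import Mathlib

/-!
# Prokhorov compactness on the box `[0,1]×[-π,π]²` for the joint spectral measure

Pure measure theory (Prokhorov on a compact set + portmanteau), used by line `Sketch`
(canonical-lift spine) of the crux `CriticalTwoPointGSM` (stmt-CriticalPhenomena-8365), stub
`js_compactness`. A point of the spectral side is `p : Fin 3 → ℝ` with `p 0 = λ ∈ [0,1]` and
`(p 1, p 2) = k ∈ [-π,π]²`; the joint kernel is `λ^{|n|} cos(k·z)` for `n ∈ ℤ`, `z ∈ ℤ²`.

If probability measures `ρ_N` on `ℝ³ = (Fin 3 → ℝ)` are all carried by the box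
`S = {p | 0 ≤ p 0 ≤ 1 ∧ ∀ j, -π ≤ p j.succ ≤ π}` and their joint moments
`∫ (p 0)^{|n|} cos(∑ⱼ p j.succ zⱼ) dρ_N` converge to `L n z` for every `(n,z)`, then some probability
measure `ρ` carried by `S` has joint moments `L n z`.

Proof: `S` is compact (closed, inside the cube `[-4,4]³` since `π ≤ 4`), so the family `{ρ_N}` is
tight for free; Prokhorov's theorem (`MeasureTheory.isCompact_closure_of_isTightMeasureSet`) and
Lévy–Prokhorov metrisability of `ProbabilityMeasure (Fin 3 → ℝ)` give a weakly convergent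
subsequence `ρ_{φ N} → ρ`; the open complement `Sᶜ` is `ρ`-null by the portmanteau inequality
`ρ Sᶜ ≤ liminf ρ_{φ N} Sᶜ = 0`; and the moments converge because on `S` the kernel agrees with the
bounded continuous clamped kernel `(max 0 (min (p 0) 1))^{|n|} cos(∑ⱼ p j.succ zⱼ) ∈ [-1,1]`,
against which weak convergence can be tested.
-/

namespace Summit.CriticalPhenomena.Ising3DConformalLimit.Theorems

open MeasureTheory Filter Topology
open scoped BigOperators

noncomputable section

namespace CriticalTwoPointGSMJs.JsCompactness

/-- The box `[0,1]×[-π,π]²` is closed. -/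
theorem isClosed_box :
    IsClosed {p : Fin 3 → ℝ | 0 ≤ p 0 ∧ p 0 ≤ 1 ∧
      ∀ j : Fin 2, -Real.pi ≤ p j.succ ∧ p j.succ ≤ Real.pi} := by
  simp only [Set.setOf_and, Set.setOf_forall]
  exact (isClosed_le continuous_const (continuous_apply 0)).inter
    ((isClosed_le (continuous_apply 0) continuous_const).inter (isClosed_iInter fun j =>
      (isClosed_le continuous_const (continuous_apply _)).inter
        (isClosed_le (continuous_apply _) continuous_const)))

/-- The box `[0,1]×[-π,π]²` is compact: a closed subset of the compact cube `[-4,4]³`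
(`π ≤ 4`). -/
theorem isCompact_box :
    IsCompact {p : Fin 3 → ℝ | 0 ≤ p 0 ∧ p 0 ≤ 1 ∧
      ∀ j : Fin 2, -Real.pi ≤ p j.succ ∧ p j.succ ≤ Real.pi} := by
  refine (isCompact_univ_pi fun _ : Fin 3 => (isCompact_Icc : IsCompact (Set.Icc (-4 : ℝ) 4)))
    |>.of_isClosed_subset isClosed_box ?_
  intro p hp
  obtain ⟨h0, h1, hk⟩ := hp
  simp only [Set.mem_univ_pi, Set.mem_Icc]
  intro i
  refine Fin.cases ?_ (fun j => ?_) i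
  · exact ⟨by linarith, by linarith⟩
  · obtain ⟨hj1, hj2⟩ := hk j
    exact ⟨by linarith [Real.pi_le_four], by linarith [Real.pi_le_four]⟩

/-- A measure giving no mass to the complement of the box is carried by the box: almost every
point lies in `[0,1]×[-π,π]²`. -/
theorem ae_mem_box {ν : Measure (Fin 3 → ℝ)}
    (h : ν {p : Fin 3 → ℝ | 0 ≤ p 0 ∧ p 0 ≤ 1 ∧
      ∀ j : Fin 2, -Real.pi ≤ p j.succ ∧ p j.succ ≤ Real.pi}ᶜ = 0) :
    ∀ᵐ p ∂ν, 0 ≤ p 0 ∧ p 0 ≤ 1 ∧ ∀ j : Fin 2, -Real.pi ≤ p j.succ ∧ p j.succ ≤ Real.pi :=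
  mem_ae_iff.2 h

/-- The clamped kernel `p ↦ (max 0 (min (p 0) 1))^{|n|} cos(∑ⱼ p j.succ zⱼ)` is continuous. -/
theorem continuous_clampKernel (n : ℤ) (z : Fin 2 → ℤ) :
    Continuous fun p : Fin 3 → ℝ =>
      (max 0 (min (p 0) 1)) ^ n.natAbs * Real.cos (∑ j : Fin 2, p j.succ * (z j : ℝ)) := by
  fun_prop

/-- The clamped kernel takes values of norm at most `1`. -/
theorem norm_clampKernel_le_one (n : ℤ) (z : Fin 2 → ℤ) (p : Fin 3 → ℝ) :
    ‖(max 0 (min (p 0) 1)) ^ n.natAbs * Real.cos (∑ j : Fin 2, p j.succ * (z j : ℝ))‖ ≤ 1 := by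
  rw [norm_mul, norm_pow, Real.norm_eq_abs, Real.norm_eq_abs, abs_of_nonneg (le_max_left _ _)]
  exact mul_le_one₀ (pow_le_one₀ (le_max_left _ _) (max_le zero_le_one (min_le_right _ _)))
    (abs_nonneg _) (Real.abs_cos_le_one _)

/-- On a measure carried by the box, the clamped kernel and the joint kernel
`p ↦ (p 0)^{|n|} cos(∑ⱼ p j.succ zⱼ)` have the same integral. -/
theorem integral_clampKernel_eq {ν : Measure (Fin 3 → ℝ)}
    (h : ν {p : Fin 3 → ℝ | 0 ≤ p 0 ∧ p 0 ≤ 1 ∧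
      ∀ j : Fin 2, -Real.pi ≤ p j.succ ∧ p j.succ ≤ Real.pi}ᶜ = 0) (n : ℤ) (z : Fin 2 → ℤ) :
    ∫ p, (max 0 (min (p 0) 1)) ^ n.natAbs * Real.cos (∑ j : Fin 2, p j.succ * (z j : ℝ)) ∂ν =
      ∫ p, (p 0) ^ n.natAbs * Real.cos (∑ j : Fin 2, p j.succ * (z j : ℝ)) ∂ν := by
  refine integral_congr_ae ?_
  filter_upwards [ae_mem_box h] with p hp
  rw [min_eq_left hp.2.1, max_eq_right hp.1]

end CriticalTwoPointGSMJs.JsCompactness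

open CriticalTwoPointGSMJs.JsCompactness in
/-- **Prokhorov on the compact support (stub `js_compactness`).** Probability measures on `ℝ³`
carried by the compact box `[0,1]×[-π,π]²` whose joint moments `∫ λ^{|n|} cos(k·z) dρ_N` converge
to `L n z` for every `(n,z)` admit a probability measure carried by the box whose joint moments are
the limits `L n z`: tightness is free on a compact set, Prokhorov + Lévy–Prokhorov metrisability
give a weakly convergent subsequence, portmanteau for the open complement of the box, and weak
convergence is tested on the bounded continuous clamped kernels
`(max 0 (min λ 1))^{|n|} cos(k·z)`, which agree with the kernel where all the measures live. -/
theorem js_compactness : ∀ (ρs : ℕ → Measure (Fin 3 → ℝ)) (L : ℤ → (Fin 2 → ℤ) → ℝ),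
    (∀ N, IsProbabilityMeasure (ρs N)) →
    (∀ N, (ρs N) {p | 0 ≤ p 0 ∧ p 0 ≤ 1 ∧ ∀ j : Fin 2, -Real.pi ≤ p j.succ ∧ p j.succ ≤ Real.pi}ᶜ = 0) →
    (∀ (n : ℤ) (z : Fin 2 → ℤ), Tendsto (fun N =>
      ∫ p, (p 0) ^ n.natAbs * Real.cos (∑ j : Fin 2, p j.succ * (z j : ℝ)) ∂(ρs N)) atTop (𝓝 (L n z))) →
    ∃ ρ : Measure (Fin 3 → ℝ), IsProbabilityMeasure ρ ∧
      ρ {p | 0 ≤ p 0 ∧ p 0 ≤ 1 ∧ ∀ j : Fin 2, -Real.pi ≤ p j.succ ∧ p j.succ ≤ Real.pi}ᶜ = 0 ∧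
      ∀ (n : ℤ) (z : Fin 2 → ℤ),
        ∫ p, (p 0) ^ n.natAbs * Real.cos (∑ j : Fin 2, p j.succ * (z j : ℝ)) ∂ρ = L n z := by
  intro ρs L hP hsupp hlim
  -- Step 1: package the `ρs N` as probability measures; tight for free since the box is compact.
  let P : ℕ → ProbabilityMeasure (Fin 3 → ℝ) := fun N => ⟨ρs N, hP N⟩
  have htight : IsTightMeasureSet
      {((Q : ProbabilityMeasure (Fin 3 → ℝ)) : Measure (Fin 3 → ℝ)) | Q ∈ Set.range P} := by
    rw [isTightMeasureSet_iff_exists_isCompact_measure_compl_le]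
    intro ε _
    refine ⟨_, isCompact_box, ?_⟩
    rintro _ ⟨Q, ⟨N, rfl⟩, rfl⟩
    show (ρs N) _ ≤ ε
    exact (hsupp N).trans_le zero_le
  -- Step 2: Prokhorov + Lévy–Prokhorov metrisability: a weakly convergent subsequence.
  obtain ⟨μ, -, φ, hφ, hμ⟩ := (isCompact_closure_of_isTightMeasureSet htight).tendsto_subseq
    (x := P) fun N => subset_closure (Set.mem_range_self N)
  -- Step 3: the limit is carried by the box (portmanteau for the open complement).
  have hsuppμ : (μ : Measure (Fin 3 → ℝ))
      {p | 0 ≤ p 0 ∧ p 0 ≤ 1 ∧ ∀ j : Fin 2, -Real.pi ≤ p j.succ ∧ p j.succ ≤ Real.pi}ᶜ = 0 := by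
    have h := ProbabilityMeasure.le_liminf_measure_open_of_tendsto hμ isClosed_box.isOpen_compl
    have h0 : (fun N => ((P ∘ φ) N : Measure (Fin 3 → ℝ))
        {p | 0 ≤ p 0 ∧ p 0 ≤ 1 ∧ ∀ j : Fin 2, -Real.pi ≤ p j.succ ∧ p j.succ ≤ Real.pi}ᶜ) =
        fun _ => 0 := by
      funext N
      exact hsupp (φ N)
    rw [h0, liminf_const] at h
    exact le_antisymm h bot_le
  refine ⟨μ, inferInstance, hsuppμ, fun n z => ?_⟩
  -- Step 4: test weak convergence on the bounded continuous clamped kernel.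
  let f : BoundedContinuousFunction (Fin 3 → ℝ) ℝ :=
    BoundedContinuousFunction.ofNormedAddCommGroup
      (fun p : Fin 3 → ℝ =>
        (max 0 (min (p 0) 1)) ^ n.natAbs * Real.cos (∑ j : Fin 2, p j.succ * (z j : ℝ)))
      (continuous_clampKernel n z) 1 (norm_clampKernel_le_one n z)
  have hf := (ProbabilityMeasure.tendsto_iff_forall_integral_tendsto.1 hμ) f
  have h1 : (fun N => ∫ p, f p ∂((P ∘ φ) N : Measure (Fin 3 → ℝ))) = fun N =>
      ∫ p, (p 0) ^ n.natAbs * Real.cos (∑ j : Fin 2, p j.succ * (z j : ℝ)) ∂(ρs (φ N)) := by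
    funext N
    exact integral_clampKernel_eq (hsupp (φ N)) n z
  have h2 : ∫ p, f p ∂(μ : Measure (Fin 3 → ℝ)) =
      ∫ p, (p 0) ^ n.natAbs * Real.cos (∑ j : Fin 2, p j.succ * (z j : ℝ))
        ∂(μ : Measure (Fin 3 → ℝ)) :=
    integral_clampKernel_eq hsuppμ n z
  rw [h1, h2] at hf
  exact (tendsto_nhds_unique ((hlim n z).comp hφ.tendsto_atTop) hf).symm

end

end Summit.CriticalPhenomena.Ising3DConformalLimit.Theorems
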